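import Literature.MathematicalPhysics.QuantumLattice.SpinChainsAkltFrustrationFreeProofs
import Literature.MathematicalPhysics.QuantumLattice.MatrixProductStatesAkltChainProofs
import HarnessLib

/-!
# Discharged fact: the AKLT ring has a unique ground state (`aklt_unique_periodic`)

Trunk **T-QLATTICE**. Sibling proof file of
`Literature/MathematicalPhysics/QuantumLattice/SpinChains.lean` (next to
`SpinChainsAkltGroundStateProofs.lean` and `SpinChainsAkltFrustrationFreeProofs.lean`, whose
`akltVBS_ne_zero`, `akltRing_groundEnergy` and `mulVec_eq_zero_of_sum_posSemidef` it reuses). It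
discharges the named fact (`def X : Prop`, D-0014)

* `Literature.MathematicalPhysics.QuantumLattice.aklt_unique_periodic` (statement hubbard S15 of
  `SpinChains.lean`) — for `3 ≤ L` the AKLT ring
  `H_L = Σ_{i ∈ ℤ/L} (𝐒_i · 𝐒_{i+1} + ⅓ (𝐒_i · 𝐒_{i+1})²)` has a unique ground state
  (`aklt_unique_periodic_holds`), namely the valence-bond-solid state `akltVBS L`;

no statement or definition is introduced or changed (the file is theorem-only). The MPS algebra
(Fannes–Nachtergaele–Werner Lemma 5.5 and Example 7) lives in
`MatrixProductStatesIntersectionProofs.lean` / `MatrixProductStatesAkltChainProofs.lean`; this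
file closes the chain up on the ring and does the spectral bookkeeping.

## Sources

* M. Fannes, B. Nachtergaele, R. F. Werner, *Finitely correlated states on quantum spin
  chains*, Comm. Math. Phys. **144** (1992) 443–490 (held: `paper:doi-10-1007-bf02099178`):
  §5 p. 468 ("The kernel of `H_{{1,…,m}}` is clearly equal to the intersection of the kernels of
  the positive operators `h_k`"), Def. 5.4 (the kernel of `h` is `𝒢_ℓ`), Lemma 5.5
  (pp. 468–469, intersection property), Theorem 5.7 (p. 470, uniqueness of the zero-energy state
  on the infinite chain), Example 7 (p. 473: for the AKLT family `ℓ₀ = 2`, the intersection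
  property holds at `ℓ = 2`, and "any positive nearest neighbor interaction `h_θ` with
  `ker h_θ = 𝒢₂`, will lead to a VBS model having `ω_θ` as its unique ground state"), §7
  pp. 485–486 (for `J = 1`, `j = 1/2` "the nearest neighbor interaction `h` is precisely the
  AKLT model").
* D. Perez-Garcia, F. Verstraete, M. M. Wolf, J. I. Cirac, *Matrix product state
  representations*, Quantum Inf. Comput. **7** (2007) 401–430 (held: arXiv:quant-ph/0608197),
  §4.1.2 Theorem 10 (uniqueness with translation invariance and periodic boundary conditions):
  "any ground state `|φ⟩` of `H_{𝒢_L}` is in `𝒢_N` … Since there is no distinguished first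
  position, `|φ⟩` can also be written `Σ tr(A_{i₁} ⋯ A_{i_{L₀}} Y A_{i_{L₀+1}} ⋯ A_{i_N})` … By
  condition C1, `X A_{i₁} ⋯ A_{i_{L₀}} = A_{i₁} ⋯ A_{i_{L₀}} Y` … Hence `X = Y` which, in
  addition, commutes with `A_{i₁} ⋯ A_{i_{L₀}}` … `X = λ𝟙` and `|φ⟩ = |ψ⟩`." This is the
  finite-ring statement proved here (with origin shifts by one site).
* I. Affleck, T. Kennedy, E. H. Lieb, H. Tasaki, Comm. Math. Phys. **115** (1988) 477–528,
  Theorem 1 and §2 (p. 483, the periodic chain); H. Tasaki (2020), Theorem 7.2.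

## Proof

Let `3 ≤ N`, `A` the AKLT tensor, `H = parentHamiltonian N 2 A = Σ_x P₂(x, x+1)`.
1. `exists_boundary_of_parentHamiltonian_mulVec_eq_zero`: `H φ = 0` ⇒ each bond term kills
   `φ` (sum of positive semidefinite matrices, `mulVec_eq_zero_of_sum_posSemidef`) ⇒ every
   two-site bond slice of `φ` lies in `ker P₂ = 𝒢₂ = {ψ_B}` (`localOp_mulVec_extend_val`,
   relabelling `i ↦ x + i`, and `exists_mpsWithBoundary_of_parentLocalTerm_mulVec_eq_zero` from
   `parentLocalTerm_two_akltTensor` and `mpsWithBoundary_two_aklt_eq_sub_akltProj_mulVec`).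
2. `exists_eq_smul_akltVBS` (PVWC Thm 10): reading the ring from an origin `k` along
   `i ↦ k + i` turns `φ` into a vector on the open chain `Fin N` with all bond slices in `𝒢₂`,
   hence (`exists_boundary_of_twoSiteSlices_aklt`, FNW Lemma 5.5 + Example 7)
   `φ(σ) = tr (X_k A^{σ_k} ⋯ A^{σ_{k+N-1}})`. Comparing `k` and `k + 1` (the word is rotated by
   one letter) and using injectivity on words of length `N - 1 ≥ 2`
   (`eq_of_trace_mul_wordProduct_eq`) gives `X_k A^s = A^s X_{k+1}`; iterating along a word of
   length `N` gives `X_0 A^w = A^w X_0`, so `X_0 = c 𝟙`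
   (`exists_eq_smul_one_of_commute_wordProduct`) and `φ = c Ω`, `Ω = akltVBS N`.
3. `aklt_unique_periodic_holds`: `H_AKLT = 2H - 2N/3` (`akltRing_eq_two_smul_parentHamiltonian_sub`),
   so `H_AKLT φ = -(2N/3) φ ↔ H φ = 0`; with `E₀(H_AKLT) = -2N/3` (`akltRing_groundEnergy`)
   the ground space is `ker H = ℂ Ω` by 1–2 (`H Ω = 0`, `Ω ≠ 0`), and `finrank (ℂ Ω) = 1`.

## References

* M. Fannes, B. Nachtergaele, R. F. Werner, Comm. Math. Phys. **144** (1992) 443–490,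
  doi:10.1007/bf02099178, §5 (p. 468, Def. 5.4, Lemma 5.5, Thm 5.7), Example 7 (p. 473), §7
  (pp. 485–486). [FannesNachtergaeleWernerCMP1992]
* D. Perez-Garcia, F. Verstraete, M. M. Wolf, J. I. Cirac, Quantum Inf. Comput. **7** (2007)
  401–430, arXiv:quant-ph/0608197, §4.1.2 Theorem 10. [PerezGarciaVerstraeteWolfCiracQIC2007]
* I. Affleck, T. Kennedy, E. H. Lieb, H. Tasaki, Comm. Math. Phys. **115** (1988) 477–528,
  Thm 1, §2. [AKLT1988]
* H. Tasaki, *Physics and Mathematics of Quantum Many-Body Systems* (Springer, 2020), Thm 7.2.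
  [Tasaki2020]
-/

noncomputable section

open Matrix
open scoped ComplexOrder MatrixOrder

namespace Literature.MathematicalPhysics.QuantumLattice

section QLattice

variable {q D : ℕ}

/-! ### Ring closure (Perez-Garcia–Verstraete–Wolf–Cirac, Theorem 10) -/

/-- Membership in a block of the ring: `y ∈ {x, …, x+ℓ-1}` iff `y = x + i` for some `i < ℓ`.
[folklore] -/
theorem mem_ringBlock_iff {L ℓ : ℕ} (x y : ZMod L) :
    y ∈ ringBlock L ℓ x ↔ ∃ i : Fin ℓ, y = x + ((i : ℕ) : ZMod L) := by
  simp [ringBlock, eq_comm]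

/-- **Uniqueness on the ring (PVWC Theorem 10 for the AKLT tensor).** Let `3 ≤ N`. If every
nearest-neighbour two-site slice of a vector `φ` on the ring `ℤ/N` of spin-`1` sites is an AKLT
two-site amplitude `ψ_B` (i.e. `φ` is annihilated by every bond projection `P₂(x, x+1)`), then
`φ` is a multiple of the valence-bond-solid state `akltVBS N = tr (A^{σ₀} ⋯ A^{σ_{N-1}})`.
Proof as printed: reading the ring from any origin `k`, the open-chain result
(`exists_boundary_of_twoSiteSlices_aklt`, FNW Lemma 5.5 + Example 7) gives
`φ(σ) = tr (X_k A^{σ_k} ⋯ A^{σ_{k+N-1}})`; comparing origins `k` and `k+1` by injectivity on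
words of length `N - 1 ≥ 2` gives `X_k A^s = A^s X_{k+1}`, hence `X_0` commutes with all words
of length `N` and is a scalar. Perez-Garcia–Verstraete–Wolf–Cirac, QIC 7 (2007), §4.1.2,
Theorem 10; Fannes–Nachtergaele–Werner (1992) Theorem 5.7 is the infinite-chain analogue.
[cite: PerezGarciaVerstraeteWolfCiracQIC2007, §4.1.2 Theorem 10] -/
theorem exists_eq_smul_akltVBS (N : ℕ) [NeZero N] (hN : 3 ≤ N)
    (φ : TensorIndex (ZMod N) 3 → ℂ)
    (hφ : ∀ (x : ZMod N) (σ : TensorIndex (ZMod N) 3), ∃ B : Matrix (Fin 2) (Fin 2) ℂ,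
      ∀ τ : TensorIndex (ZMod N) 3, (∀ y, y ∉ ringBlock N 2 x → σ y = τ y) →
        φ τ = mpsWithBoundary 2 akltTensor B (fun i : Fin 2 => τ (x + ((i : ℕ) : ZMod N)))) :
    ∃ c : ℂ, φ = c • akltVBS N := by
  -- reading the ring from the origin `k`: `i ↦ k + i`
  set e : ZMod N → Fin N ≃ ZMod N := fun k =>
    (ZMod.finEquiv N).toEquiv.trans (Equiv.addLeft k) with he_def
  have he : ∀ (k : ZMod N) (i : Fin N), e k i = k + ((i : ℕ) : ZMod N) := fun k i => by
    simp [he_def, finEquiv_apply_eq_natCast]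
  -- Step 1: along every origin, `φ` is an open-chain boundary MPS
  have hX : ∀ k : ZMod N, ∃ X : Matrix (Fin 2) (Fin 2) ℂ, ∀ τ : TensorIndex (ZMod N) 3,
      φ τ = (X * wordProduct akltTensor (τ ∘ e k)).trace := by
    intro k
    obtain ⟨X, hXw⟩ := exists_boundary_of_twoSiteSlices_aklt N (by omega)
      (fun w => φ (w ∘ (e k).symm)) fun j hj σ => by
        obtain ⟨B, hB⟩ := hφ (e k ⟨j, by omega⟩) (σ ∘ (e k).symm)
        refine ⟨B, fun τ hτ => ?_⟩
        have hmem : ∀ i : Fin 2, e k ⟨j + i, by omega⟩ ∈ ringBlock N 2 (e k ⟨j, by omega⟩) :=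
          fun i => (mem_ringBlock_iff _ _).2 ⟨i, by rw [he, he]; push_cast; ring⟩
        have h := hB (τ ∘ (e k).symm) fun y hy => by
          simp only [Function.comp_apply]
          refine hτ _ (fun hval => hy ?_) (fun hval => hy ?_)
          · have hy' : y = e k ⟨j + ((0 : Fin 2) : ℕ), by omega⟩ :=
              ((e k).symm_apply_eq).1 (Fin.ext (by simpa using hval))
            rw [hy']
            exact hmem 0
          · have hy' : y = e k ⟨j + ((1 : Fin 2) : ℕ), by omega⟩ :=
              ((e k).symm_apply_eq).1 (Fin.ext (by simpa using hval))
            rw [hy']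
            exact hmem 1
        rw [h]
        congr 1
        funext i
        simp only [Function.comp_apply]
        congr 1
        rw [Equiv.symm_apply_eq, he, he]
        push_cast
        ring
    refine ⟨X, fun τ => ?_⟩
    have h := hXw (τ ∘ e k)
    rw [Function.comp_assoc, Equiv.self_comp_symm, Function.comp_id] at h
    exact h
  choose X hX using hX
  -- Step 2: shifting the origin by one rotates the word
  obtain ⟨n, rfl⟩ : ∃ n, N = n + 1 := ⟨N - 1, by omega⟩
  have hrot : ∀ (k : ZMod (n + 1)) (τ : TensorIndex (ZMod (n + 1)) 3),
      τ ∘ e (k + 1) = Fin.snoc (Fin.tail (τ ∘ e k)) ((τ ∘ e k) 0) := by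
    intro k τ
    funext i
    refine Fin.lastCases ?_ (fun i' => ?_) i
    · simp only [Function.comp_apply, Fin.snoc_last, he, Fin.val_last, Fin.val_zero,
        Nat.cast_zero, add_zero]
      have h1n : (1 : ZMod (n + 1)) + (n : ZMod (n + 1)) = 0 := by
        have h := ZMod.natCast_self (n + 1)
        push_cast at h
        linear_combination h
      congr 1
      rw [add_assoc, h1n, add_zero]
    · simp only [Function.comp_apply, Fin.snoc_castSucc, Fin.tail, he, Fin.val_castSucc,
        Fin.val_succ]
      congr 1
      push_cast
      ring
  -- Step 3: `X_k A^s = A^s X_{k+1}`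
  have hinj : ∀ ℓ, 2 ≤ ℓ → IsInjectiveMPS akltTensor ℓ := fun ℓ hℓ =>
    IsInjectiveMPS.of_le isInjectiveMPS_akltTensor_two two_pos hℓ
  have key : ∀ (k : ZMod (n + 1)) (s : Fin 3),
      X k * akltTensor s = akltTensor s * X (k + 1) := by
    intro k s
    refine eq_of_trace_mul_wordProduct_eq (hinj n (by omega)) fun m => ?_
    set τ : TensorIndex (ZMod (n + 1)) 3 := (Fin.cons s m : Fin (n + 1) → Fin 3) ∘ (e k).symm
      with hτ
    have hτk : τ ∘ e k = Fin.cons s m := by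
      rw [hτ, Function.comp_assoc, Equiv.symm_comp_self, Function.comp_id]
    have h1 := hX k τ
    have h2 := hX (k + 1) τ
    rw [hrot, hτk, Fin.tail_cons, Fin.cons_zero, wordProduct_snoc] at h2
    rw [hτk, wordProduct_cons, h2] at h1
    rw [Matrix.mul_assoc, Matrix.mul_assoc, ← h1, trace_mul_cycle']
  -- Step 4: `X_0` commutes with every word of length `N`
  have hcomm : ∀ (ℓ : ℕ) (w : Fin ℓ → Fin 3) (k : ZMod (n + 1)),
      X k * wordProduct akltTensor w = wordProduct akltTensor w * X (k + (ℓ : ZMod (n + 1))) := by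
    intro ℓ
    induction ℓ with
    | zero =>
      intro w k
      simp [wordProduct]
    | succ ℓ ih =>
      intro w k
      rw [← Fin.cons_self_tail w, wordProduct_cons, ← Matrix.mul_assoc, key, Matrix.mul_assoc, ih,
        Matrix.mul_assoc]
      congr 3
      push_cast
      ring
  have hcomm0 : ∀ w : Fin (n + 1) → Fin 3,
      X 0 * wordProduct akltTensor w = wordProduct akltTensor w * X 0 := by
    intro w
    have h := hcomm (n + 1) w 0
    rwa [zero_add, ZMod.natCast_self] at h
  obtain ⟨c, hc⟩ := exists_eq_smul_one_of_commute_wordProduct (hinj (n + 1) (by omega)) hcomm0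
  -- Step 5: `φ = c • Ω`
  refine ⟨c, funext fun τ => ?_⟩
  have h0 : τ ∘ e 0 = τ ∘ ZMod.finEquiv (n + 1) := by
    funext i
    simp only [Function.comp_apply, he, zero_add, finEquiv_apply_eq_natCast]
  rw [hX 0, hc, Pi.smul_apply, akltVBS, mpsPeriodic_apply, smul_eq_mul, Matrix.smul_mul,
    Matrix.one_mul, trace_smul, smul_eq_mul, h0]

/-! ### Kernel of the parent Hamiltonian: every block slice is a boundary MPS -/

/-- A two-site vector annihilated by the AKLT parent term `h = 1 - P_{𝒢₂} = P₂` is an AKLT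
two-site amplitude `ψ_B` (`ker P₂ = 𝒢₂`: `u = (u - P₂ u) + P₂ u` and `u - P₂ u = ψ_{B(u)}`,
`mpsWithBoundary_two_aklt_eq_sub_akltProj_mulVec`). Fannes–Nachtergaele–Werner (1992) Def. 5.4
("the kernel of `h` coincides with `𝒢_ℓ`") and §7, p. 485. [folklore] -/
theorem exists_mpsWithBoundary_of_parentLocalTerm_mulVec_eq_zero (u : (Fin 2 → Fin 3) → ℂ)
    (hu : parentLocalTerm 2 akltTensor *ᵥ u = 0) :
    ∃ B : Matrix (Fin 2) (Fin 2) ℂ, mpsWithBoundary 2 akltTensor B = u := by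
  obtain ⟨s, t, hs, ht, hA⟩ := akltTensor_eq_of_sq
  have h := mpsWithBoundary_two_aklt_eq_sub_akltProj_mulVec s t hs ht u
  rw [← parentLocalTerm_two_akltTensor, hu, sub_zero, ← hA] at h
  exact ⟨_, h⟩

/-- **Zero-energy vectors of the AKLT parent Hamiltonian have all bond slices in `𝒢₂`.** For
`2 ≤ N`, if `H φ = 0` for the parent Hamiltonian `H = Σ_x h_{x,x+1}` of the AKLT tensor on the
ring `ℤ/N`, then along every bond `{x, x+1}` and for every frozen configuration off the bond the
two-site slice of `φ` is an AKLT amplitude `ψ_B` (the converse hypothesis of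
`parentHamiltonian_mulVec_eq_zero_of_exists_boundary`): `H φ = 0` forces `h_{x,x+1} φ = 0` for
each `x` (positivity, `mulVec_eq_zero_of_sum_posSemidef`), `h_{x,x+1} = P₂ ⊗ 𝟙` acts by `P₂` on
the bond slices (`localOp_mulVec_extend_val`, relabelled along `i ↦ x + i`), and `ker P₂ = 𝒢₂`.
Fannes–Nachtergaele–Werner (1992) §5, p. 468 (kernel of `H_{1,…,m}` = intersection of the
kernels of the `h_k`) and Def. 5.4. [cite: FannesNachtergaeleWernerCMP1992, §5 Def. 5.4 and p. 468] -/
theorem exists_boundary_of_parentHamiltonian_mulVec_eq_zero (N : ℕ) [NeZero N] (hN : 2 ≤ N)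
    (φ : TensorIndex (ZMod N) 3 → ℂ) (h0 : parentHamiltonian N 2 akltTensor *ᵥ φ = 0)
    (x : ZMod N) (σ : TensorIndex (ZMod N) 3) :
    ∃ B : Matrix (Fin 2) (Fin 2) ℂ, ∀ τ : TensorIndex (ZMod N) 3,
      (∀ y, y ∉ ringBlock N 2 x → σ y = τ y) →
        φ τ = mpsWithBoundary 2 akltTensor B (fun i : Fin 2 => τ (x + ((i : ℕ) : ZMod N))) := by
  -- the bond term at `x` kills `φ`
  have hx : localOp (ringBlock N 2 x) (onRingBlock N 2 x (parentLocalTerm 2 akltTensor)) *ᵥ φ =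
      0 := by
    unfold parentHamiltonian at h0
    exact mulVec_eq_zero_of_sum_posSemidef (fun y _ => posSemidef_localOp _
      (posSemidef_onRingBlock N 2 y (parentLocalTerm_posSemidef 2 akltTensor))) h0 x
      (Finset.mem_univ x)
  -- hence `P₂` kills the bond slice of `φ` at `σ`, relabelled by `Fin 2`
  have hf : Function.Bijective fun (ρ : ringBlock N 2 x → Fin 3) (i : Fin 2) =>
      ρ (ringBlockSite N 2 x i) :=
    (ringBlockSite_bijective N 2 hN x).comp_right
  set g := Equiv.ofBijective _ hf with hg
  have hslice := localOp_mulVec_extend_val (ringBlock N 2 x)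
    (onRingBlock N 2 x (parentLocalTerm 2 akltTensor)) φ σ
  rw [hx] at hslice
  have hker : parentLocalTerm 2 akltTensor *ᵥ
      ((fun β : ringBlock N 2 x → Fin 3 => φ (Subtype.val.extend β σ)) ∘ g.symm) = 0 := by
    have h2 : (parentLocalTerm 2 akltTensor).submatrix g g *ᵥ
        (fun β : ringBlock N 2 x → Fin 3 => φ (Subtype.val.extend β σ)) = 0 := hslice.symm
    rw [submatrix_mulVec_equiv] at h2
    funext w
    have h3 := congrFun h2 (g.symm w)
    simpa using h3
  obtain ⟨B, hB⟩ := exists_mpsWithBoundary_of_parentLocalTerm_mulVec_eq_zero _ hker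
  refine ⟨B, fun τ hτ => ?_⟩
  have hβ : φ τ = mpsWithBoundary 2 akltTensor B (g fun y : ringBlock N 2 x => τ y) := by
    have h4 := congrFun hB (g fun y : ringBlock N 2 x => τ y)
    simp only [Function.comp_apply, Equiv.symm_apply_apply] at h4
    rw [h4, extend_val_restrict_eq_of_forall _ hτ]
  rw [hβ]
  rfl

/-! ### The AKLT ring: Hamiltonian, valence-bond state, ground space -/

/-- `H_AKLT = 2 H_parent - 2N/3` on the ring `ℤ/N`, `2 ≤ N`: each bond term
`𝐒·𝐒 + ⅓(𝐒·𝐒)² = 2 P₂ - ⅔` (`parentHamiltonian_akltTensor_eq_holds`). AKLT, CMP 115 (1988),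
eq. (1.2); Fannes–Nachtergaele–Werner (1992) eq. (1.1). [folklore] -/
theorem akltRing_eq_two_smul_parentHamiltonian_sub (N : ℕ) [NeZero N] (hN : 2 ≤ N) :
    akltRing N = (2 : ℂ) • parentHamiltonian N 2 akltTensor -
      ((2 * N / 3 : ℂ)) • (1 : Op (ZMod N) 3) := by
  rw [parentHamiltonian_akltTensor_eq_holds N hN, Finset.smul_sum, akltRing]
  have hterm : ∀ i : ZMod N,
      (2 : ℂ) • ((1 / 6 : ℂ) • (spinDot 2 i (i + 1) * spinDot 2 i (i + 1)) +
        (1 / 2 : ℂ) • spinDot 2 i (i + 1) + (1 / 3 : ℂ) • (1 : Op (ZMod N) 3)) =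
      akltBond i (i + 1) + (2 / 3 : ℂ) • (1 : Op (ZMod N) 3) := by
    intro i
    simp only [akltBond, smul_add, smul_smul]
    norm_num
    abel
  simp only [hterm, Finset.sum_add_distrib, Finset.sum_const, Finset.card_univ, ZMod.card]
  rw [add_sub_assoc, eq_comm, add_eq_left, sub_eq_zero, ← Nat.cast_smul_eq_nsmul ℂ, smul_smul]
  congr 1
  ring

/-- **Discharge of `aklt_unique_periodic`: the AKLT ring has a unique ground state for
`3 ≤ L`.** Write `H_AKLT = 2H - 2L/3` with `H = Σ_x P₂(x,x+1) ≥ 0` the parent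
Hamiltonian of the AKLT tensor (`akltRing_eq_two_smul_parentHamiltonian_sub`). The VBS state
`Ω_L` is a zero mode of `H` and is nonzero, and `E₀(H_AKLT) = -2L/3`
(`akltRing_groundEnergy`, `akltVBS_ne_zero` of the sibling AKLT proof files), so the ground
space of `H_AKLT` is `ker H`.
A vector in `ker H` has all its bond slices in `𝒢₂ = ker P₂`
(`exists_boundary_of_parentHamiltonian_mulVec_eq_zero`), hence is a multiple of `Ω_L`
(`exists_eq_smul_akltVBS`: FNW Lemma 5.5 with the `ℓ = 2` intersection property of Example 7
along the open chain, closed up on the ring as in Perez-Garcia–Verstraete–Wolf–Cirac Thm 10).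
So the ground space is the line `ℂ Ω_L` and `dim = 1`. Fannes–Nachtergaele–Werner, CMP 144
(1992), §5 Lemma 5.5, Theorem 5.7, Example 7 (p. 473) and §7 (pp. 485–486: for `J = 1`,
`j = 1/2` "the nearest neighbor interaction `h` is precisely the AKLT model" and `ω` is its
unique ground state); Affleck–Kennedy–Lieb–Tasaki, CMP 115 (1988) Thm 1; Perez-Garcia–
Verstraete–Wolf–Cirac, QIC 7 (2007) Thm 10; Tasaki (2020) Thm 7.2.
[cite: FannesNachtergaeleWernerCMP1992, §5 Lemma 5.5 and Example 7 (p. 473) and §7 pp. 485–486] -/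
theorem aklt_unique_periodic_holds : aklt_unique_periodic := by
  intro N _ hN
  have hN2 : 2 ≤ N := by omega
  have hring := akltRing_eq_two_smul_parentHamiltonian_sub N hN2
  -- the eigen-equation at `E₀ = -2N/3` (`akltRing_groundEnergy`) is `H φ = 0`
  have hiff : ∀ φ : TensorIndex (ZMod N) 3 → ℂ,
      akltRing N *ᵥ φ = ((-(2 * N / 3) : ℝ) : ℂ) • φ ↔
        parentHamiltonian N 2 akltTensor *ᵥ φ = 0 := by
    intro φ
    rw [hring, sub_mulVec, smul_mulVec, smul_mulVec, one_mulVec]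
    push_cast
    rw [neg_smul, sub_eq_neg_self, smul_eq_zero]
    exact or_iff_right two_ne_zero
  have hVBS0 : parentHamiltonian N 2 akltTensor *ᵥ akltVBS N = 0 :=
    parentHamiltonian_mulVec_mps_eq_zero_holds N 2 hN2 akltTensor
  have hVBSne := akltVBS_ne_zero N hN2
  -- ground space `= ℂ Ω`
  have hGS : (akltRing N).groundSpace = ℂ ∙ akltVBS N := by
    ext φ
    rw [mem_groundSpace_iff, akltRing_groundEnergy N hN2, hiff, Submodule.mem_span_singleton]
    constructor
    · intro h0
      obtain ⟨c, hc⟩ := exists_eq_smul_akltVBS N hN φ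
        (exists_boundary_of_parentHamiltonian_mulVec_eq_zero N hN2 φ h0)
      exact ⟨c, hc.symm⟩
    · rintro ⟨c, rfl⟩
      rw [mulVec_smul, hVBS0, smul_zero]
  rw [Matrix.HasUniqueGroundState, Matrix.groundStateDegeneracy, hGS, finrank_span_singleton hVBSne]

end QLattice

end Literature.MathematicalPhysics.QuantumLattice
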